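import Mathlib.Data.Nat.Totient
import Summits.QuantumAdvantage.Statement
import Summits.QuantumAdvantage.QuantumAdvantage.Theorems.LinnikCubicClassGroupsPureCubicClassNumberHardHonda25
import Summits.QuantumAdvantage.QuantumAdvantage.Theorems.PhiHidingThreePresentations
import Summits.QuantumAdvantage.QuantumAdvantage.Theorems.PhiHidingThreeInfinitelyOften
import Literature.Computability.Cryptography.HondaLeakLeavesUnderBQPCollapse
import Literature.Barriers.QuantumAdvantage.SeparationPrerequisitesProofs
import HarnessLib
import HarnessLib.Audit

set_option linter.dupNamespace false -- D-0017: single-problem summit ⇒ `QuantumAdvantage.QuantumAdvantage` by design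

/-!
# Worst-case Φ-hiding for the exponent `e = 3` (`PhiHidingThree`) — conjecture obligation

Summit-side OBLIGATION file (gate ruling `literature.conjecture`, precedent
`Theorems/FactoringAssumption.lean`: an unproven conjecture is a `@[conjecture] def … : Prop` under
`Summits/<S>/<Sub>/Theorems/`, referenced by name and used only as a hypothesis; no `_holds` is
expected).  Consumer: crux `stmt-QuantumAdvantage-11826` = `PureCubicClassNumberHard` (route
`LinnikCubicClassGroups`, line `Sketch`, honda-leak arm), whose skeleton v3 has exactly one
remaining stub, the hypothesis-type leaf `stub_phiHiding3`.  This file NAMES that leaf, proves the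
name IS the stub (`phiHidingThree_iff_stub`), and certifies the wall on both sides:

* `PhiHidingThree` — the OPEN CONJECTURE: worst-case decisional Φ-hiding for the FIXED exponent
  `e = 3` against uniform PPT adversaries, on the family of squarefree semiprimes
  `N = pq ≡ 1 (mod 9)` outside the residue class `p ≡ q ≡ 8 (mod 9)`: no PPT `D` outputs
  `[3 ∣ φ(N)]` with probability `≥ 2/3` on every member.  Cachin–Micali–Stadler 1999, §2 (the
  Φ-Hiding Assumption: deciding whether a small prime `e` divides `φ(N)` is hard; here `e = 3`
  fixed, worst case instead of their average case, and the `N mod 3` leak of their Remark 1 is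
  closed by the promise `p ≡ q (mod 3)`, exactly the restriction to "`e ∤ N − 1`-safe" moduli used by
  Kiltz–O'Neill–Smith, CRYPTO 2010, §5.2).
* `modNine_promise_iff`, `mod_three_eq_of_modNine`, `decide_modThree_eq_decide_three_dvd_totient` —
  the arithmetic normal form: modulo `9` the stub's promise "`p ≡ q ≡ 1 (3)` or `{p,q} ≡ {2,5} (9)`"
  is "`pq ≡ 1 (9)` and not `(8,8)`", and on it the stub's target bit `[p ≡ 1 (3)]` is the Φ-hiding
  bit `[3 ∣ φ(pq)]`.
* `phiHidingThree_iff_stub` — `PhiHidingThree ↔ stub_phiHiding3` (verbatim signature of the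
  registered stub); `pureCubicClassNumberHard_of_phiHidingThree` — the crux from the named leaf
  (through the landed transfer `pureCubicClassNumberHard_of_phiHiding3`, p111041).
* THE WALL, upward: `not_BQP_subset_BPP_of_phiHidingThree'`, `quantumAdvantage_of_phiHidingThree`
  (the leaf alone proves the SUMMIT, via `exists_randAlg_phiHidingThree_of_BQP_subset_BPP`, p114943 —
  Shor + one `BPP` query), `P_ne_PSPACE_of_phiHidingThree` and `separations_of_phiHidingThree`
  (barrier `SeparationPrerequisites`, discharged in tree): a sorry-free proof of the stub would prove
  `P ≠ PSPACE` inside the tree.  Downward: `not_phiHidingThree_of_BQP_subset_BPP` (the leaf is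
  false in any world with `BQP ⊆ BPP`).
* `exists_randAlg_totient_without_polyTime`, `phiHidingThree_false_without_polyTime`,
  `stub_false_without_polyTime` — drop `IsPolyTime` and a (deterministic, exponential-time) decider
  exists: the content of the conjecture is purely the running-time bound.
* `phiHidingThree_fullFamily` — the conjecture implies Φ-hiding(3) on the FULL family
  `N = pq ≡ 1 (mod 9)` (antitone in the family; the converse is not formal: the `(8,8)` slice).

Deliberately NOT here: the average-case (sampler) form of CMS99/KOS10 and its reduction to the
worst case (needs equidistribution of primes in residue classes mod `9`); the quadratic-residuosity
and lossy-RSA presentations of the same bit (Tier B of the stub plan, separate files).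

## References

* C. Cachin, S. Micali, M. Stadler, *Computationally Private Information Retrieval with
  Polylogarithmic Communication*, EUROCRYPT '99, LNCS 1592, §2 p. 407 (Φ-Hiding Assumption) and
  Remark 1. [CachinMicaliStadler1999]
* E. Kiltz, A. O'Neill, A. Smith, *Instantiability of RSA-OAEP under chosen-plaintext attack*,
  CRYPTO 2010, LNCS 6223, §5.2 pp. 307–308, footnote 9 (Φ-hiding for small `e`; lossiness of RSA).
* L. M. Adleman, K. S. McCurley, *Open problems in number theoretic complexity II*, ANTS-I 1994,
  LNCS 877 (problems C11/O11a). [AdlemanMcCurley1994]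
* P. W. Shor, SIAM J. Comput. 26 (1997), §5; E. Bernstein, U. Vazirani, SIAM J. Comput. 26 (1997), §1.
-/

namespace Summit.QuantumAdvantage.QuantumAdvantage.Theorems

open Literature.Computability.Complexity Literature.Computability.Complexity.Classes
open Literature.Computability.Cryptography _root_.Computability

/-! ### The named open conjecture -/

/-- OPEN CONJECTURE — **worst-case Φ-hiding for the fixed exponent `e = 3`** on the pure-cubic
promise family.  Statement: there is NO probabilistic polynomial-time algorithm `D : {0,1}* → {0,1}`
(`RandAlg.IsPolyTime id encodeBool`: genuine TM2 polynomial time on every coin string, polynomial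
coin budget — uniform PPT) such that for EVERY pair of distinct primes `p, q` with
`pq ≡ 1 (mod 9)` and not `p ≡ q ≡ 8 (mod 9)`, on input the binary code of `N = pq`, `D` outputs the
bit `[3 ∣ φ(N)]` with probability `≥ 2/3`.

Provenance: the decisional Φ-Hiding Assumption of Cachin–Micali–Stadler (EUROCRYPT '99, §2,
p. 407: for a composite `m` hiding its factorisation it is hard to decide whether a small prime
`p₀ > 2` divides `φ(m)`), specialised to the FIXED prime `e = 3`, stated in the WORST CASE over the
explicit family above (their formulation is average-case over a sampler), against UNIFORM
adversaries (theirs are circuits).  Their Remark 1 ("the assumption fails for `p₀ = 3`": if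
`m = pq ≡ 2 (mod 3)` then exactly one of `p, q` is `≡ 1 (mod 3)`, so `3 ∣ φ(m)` is read off
`m mod 3`) is evaded by the promise: every admitted `N ≡ 1 (mod 9)` has `p ≡ q (mod 3)`
(`mod_three_eq_of_modNine`), the restriction to which Φ-hiding for small `e` is customarily stated
(Kiltz–O'Neill–Smith, CRYPTO 2010, §5.2, footnote 9).  The residue class `p ≡ q ≡ 8 (mod 9)` is
removed because the consumer (Honda's criterion for `3 ∣ h(ℚ(∛N))`) does not determine the bit
there; removing inputs makes the hardness statement formally STRONGER than Φ-hiding(3) on all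
`N ≡ 1 (mod 9)` (`phiHidingThree_fullFamily`; the converse is not formal).

Status: open — [status: open].  No proof is expected: the statement alone implies the summit
`QuantumAdvantage` (`quantumAdvantage_of_phiHidingThree`) and `P ≠ PSPACE`
(`P_ne_PSPACE_of_phiHidingThree`); it is FALSE in any world with `BQP ⊆ BPP`
(`not_phiHidingThree_of_BQP_subset_BPP`, Shor's algorithm) and its only content is the time bound
(`phiHidingThree_false_without_polyTime`).  No refutation is known: the known Φ-hiding breaks need
`e ≥ N^{1/4}` (Coppersmith-type), prime-power moduli `N = PQ^{2e}`, or multi-prime `N`, none of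
which applies to `e = 3`, `N = pq`.  Registered `@[conjecture]` (CONVENTIONS §4: used only as a
hypothesis `(h : PhiHidingThree)`); it is, up to `phiHidingThree_iff_stub`, the registered stub
`stub_phiHiding3` of crux `stmt-QuantumAdvantage-11826`.
[cite: CachinMicaliStadler1999, §2 p. 407 (Φ-Hiding Assumption) and Remark 1] -/
@[conjecture] def PhiHidingThree : Prop :=
  ¬ ∃ D : RandAlg (List Bool) Bool, D.IsPolyTime id encodeBool ∧
    ∀ p q : ℕ, p.Prime → q.Prime → p ≠ q → (p * q) % 9 = 1 → ¬ (p % 9 = 8 ∧ q % 9 = 8) →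
      (2 : ℝ) / 3 ≤ D.pr id (encodeNat (p * q)) {b | b = decide (3 ∣ Nat.totient (p * q))}

/-- Unfolding of `PhiHidingThree` (by `Iff.rfl`). [cite: CachinMicaliStadler1999, §2] -/
theorem phiHidingThree_iff :
    PhiHidingThree ↔
      ¬ ∃ D : RandAlg (List Bool) Bool, D.IsPolyTime id encodeBool ∧
        ∀ p q : ℕ, p.Prime → q.Prime → p ≠ q → (p * q) % 9 = 1 → ¬ (p % 9 = 8 ∧ q % 9 = 8) →
          (2 : ℝ) / 3 ≤ D.pr id (encodeNat (p * q)) {b | b = decide (3 ∣ Nat.totient (p * q))} :=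
  Iff.rfl

/-! ### Arithmetic normal form of the promise and of the target bit -/

/-- **The promise, modulo `9`.** For ALL naturals `p, q` (no primality needed):
"`pq ≡ 1 (mod 9)` and (`p ≡ q ≡ 1 (mod 3)` or `(p, q) ≡ (2, 5)` or `(5, 2) (mod 9)`)" is the same as
"`pq ≡ 1 (mod 9)` and not `p ≡ q ≡ 8 (mod 9)`": the solutions of `ab = 1` in `ℤ/9` are
`(1,1), (4,7), (7,4), (2,5), (5,2), (8,8)`.  Finite check on residues. [folklore] -/
theorem modNine_promise_iff (p q : ℕ) :
    ((p * q) % 9 = 1 ∧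
        ((p % 3 = 1 ∧ q % 3 = 1) ∨ (p % 9 = 2 ∧ q % 9 = 5) ∨ (p % 9 = 5 ∧ q % 9 = 2))) ↔
      ((p * q) % 9 = 1 ∧ ¬ (p % 9 = 8 ∧ q % 9 = 8)) := by
  have key : ∀ a : ℕ, a < 9 → ∀ b : ℕ, b < 9 →
      ((a * b % 9 = 1 ∧ ((a % 3 = 1 ∧ b % 3 = 1) ∨ (a = 2 ∧ b = 5) ∨ (a = 5 ∧ b = 2))) ↔
        (a * b % 9 = 1 ∧ ¬ (a = 8 ∧ b = 8))) := by
    decide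
  have h := key (p % 9) (Nat.mod_lt _ (by norm_num)) (q % 9) (Nat.mod_lt _ (by norm_num))
  rwa [← Nat.mul_mod, Nat.mod_mod_of_dvd p (by norm_num : 3 ∣ 9),
    Nat.mod_mod_of_dvd q (by norm_num : 3 ∣ 9)] at h

/-- On the family (`pq ≡ 1 (mod 9)`, not `(8,8)`) the two residues agree modulo `3`:
`p ≡ q (mod 3)` — for ALL naturals.  This is what closes the `N mod 3` leak of
Cachin–Micali–Stadler's Remark 1. [folklore] -/
theorem mod_three_eq_of_modNine (p q : ℕ) (h9 : (p * q) % 9 = 1)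
    (h88 : ¬ (p % 9 = 8 ∧ q % 9 = 8)) : p % 3 = q % 3 := by
  have key : ∀ a : ℕ, a < 9 → ∀ b : ℕ, b < 9 →
      (a * b % 9 = 1 ∧ ¬ (a = 8 ∧ b = 8)) → a % 3 = b % 3 := by
    decide
  have h := key (p % 9) (Nat.mod_lt _ (by norm_num)) (q % 9) (Nat.mod_lt _ (by norm_num))
  rw [← Nat.mul_mod, Nat.mod_mod_of_dvd p (by norm_num : 3 ∣ 9),
    Nat.mod_mod_of_dvd q (by norm_num : 3 ∣ 9)] at h
  exact h ⟨h9, h88⟩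

/-- On the stub's promise ("`p ≡ q ≡ 1 (mod 3)` or `{p, q} ≡ {2, 5} (mod 9)`") the two residues agree
modulo `3`. [folklore] -/
theorem mod_three_eq_of_type {p q : ℕ}
    (ht : (p % 3 = 1 ∧ q % 3 = 1) ∨ (p % 9 = 2 ∧ q % 9 = 5) ∨ (p % 9 = 5 ∧ q % 9 = 2)) :
    p % 3 = q % 3 := by
  omega

/-- **The target bit.** For distinct primes `p ≡ q (mod 3)` the stub's bit `[p ≡ 1 (mod 3)]` is the
Φ-hiding bit `[3 ∣ φ(pq)]`: `φ(pq) = (p−1)(q−1)` and `3 ∣ (p−1)(q−1) ↔ 3 ∣ p−1 ∨ 3 ∣ q−1`.  (The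
degenerate member `p = 2`, `q ≡ 5 (mod 9)` is consistent: both bits are `false`.) [folklore] -/
theorem decide_modThree_eq_decide_three_dvd_totient {p q : ℕ} (hp : p.Prime) (hq : q.Prime)
    (hpq : p ≠ q) (h3 : p % 3 = q % 3) :
    decide (p % 3 = 1) = decide (3 ∣ Nat.totient (p * q)) := by
  rw [Nat.totient_mul ((Nat.coprime_primes hp hq).mpr hpq), Nat.totient_prime hp,
    Nat.totient_prime hq]
  have h2p : 2 ≤ p := hp.two_le
  have h2q : 2 ≤ q := hq.two_le
  refine decide_eq_decide.mpr ⟨fun h => Dvd.dvd.mul_right (by omega) _, fun h => ?_⟩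
  rcases (Nat.Prime.dvd_mul Nat.prime_three).mp h with h' | h' <;> omega

/-! ### The named conjecture IS the registered stub -/

/-- **`PhiHidingThree ↔ stub_phiHiding3`.** The right-hand side is, verbatim, the signature of the
registered stub `stub_phiHiding3` of crux `stmt-QuantumAdvantage-11826` (skeleton v3,
`Cruxes/PureCubicClassNumberHard/Lines/Sketch.lean`) and the hypothesis `hΦ` of the landed transfer
`LinnikCubicClassGroups.pureCubicClassNumberHard_of_phiHiding3`.  Same algorithm `D` both ways:
`modNine_promise_iff` converts the promise, `decide_modThree_eq_decide_three_dvd_totient` makes the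
two success events equal. [folklore] -/
theorem phiHidingThree_iff_stub :
    PhiHidingThree ↔
      ¬ ∃ D : RandAlg (List Bool) Bool, D.IsPolyTime id encodeBool ∧
        ∀ p q : ℕ, p.Prime → q.Prime → p ≠ q → (p * q) % 9 = 1 →
          ((p % 3 = 1 ∧ q % 3 = 1) ∨ (p % 9 = 2 ∧ q % 9 = 5) ∨ (p % 9 = 5 ∧ q % 9 = 2)) →
          (2 : ℝ) / 3 ≤ D.pr id (encodeNat (p * q)) {b | b = decide (p % 3 = 1)} := by
  unfold PhiHidingThree
  refine not_congr (exists_congr fun D => and_congr_right fun _ => ?_)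
  refine forall_congr' fun p => forall_congr' fun q => forall_congr' fun hp =>
    forall_congr' fun hq => forall_congr' fun hpq => forall_congr' fun h9 => ?_
  constructor
  · intro h ht
    have h88 : ¬ (p % 9 = 8 ∧ q % 9 = 8) := ((modNine_promise_iff p q).mp ⟨h9, ht⟩).2
    rw [decide_modThree_eq_decide_three_dvd_totient hp hq hpq (mod_three_eq_of_modNine p q h9 h88)]
    exact h h88
  · intro h h88
    have ht := ((modNine_promise_iff p q).mpr ⟨h9, h88⟩).2
    rw [← decide_modThree_eq_decide_three_dvd_totient hp hq hpq (mod_three_eq_of_modNine p q h9 h88)]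
    exact h ht

/-- **The crux from the named leaf**: `PhiHidingThree → PureCubicClassNumberHard`, through
`phiHidingThree_iff_stub` and the landed transfer `pureCubicClassNumberHard_of_phiHiding3`
(Honda's criterion on the promise family, proved in tree, + the landed reduction). [folklore] -/
theorem pureCubicClassNumberHard_of_phiHidingThree (h : PhiHidingThree) :
    Theses.LinnikCubicClassGroups.PureCubicClassNumberHard :=
  LinnikCubicClassGroups.pureCubicClassNumberHard_of_phiHiding3 (phiHidingThree_iff_stub.mp h)

/-! ### The wall, downward: false under the collapse `BQP ⊆ BPP` -/

/-- **`PhiHidingThree` fails in any world with `BQP ⊆ BPP`** (Shor's algorithm in `FBQP` form + one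
simulated `BPP` query: `exists_randAlg_phiHidingThree_of_BQP_subset_BPP`, p114943).  So refuting the
conjecture inside the tree is at least as hard as separating `BQP` from `BPP` is easy — i.e. a
refutation would be a classical polynomial-time algorithm for a factoring-type predicate. [folklore] -/
theorem not_phiHidingThree_of_BQP_subset_BPP (hsub : BQP ⊆ BPP) : ¬ PhiHidingThree := fun h =>
  phiHidingThree_iff_stub.mp h (exists_randAlg_phiHidingThree_of_BQP_subset_BPP hsub)

/-! ### The wall, upward: the leaf alone proves the summit and `P ≠ PSPACE` -/

/-- **`PhiHidingThree → BQP ⊄ BPP`** (the Literature theorem `not_BQP_subset_BPP_of_phiHidingThree`,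
p115703, re-keyed to the named conjecture). [folklore] -/
theorem not_BQP_subset_BPP_of_phiHidingThree' (h : PhiHidingThree) : ¬ (BQP ⊆ BPP) :=
  not_BQP_subset_BPP_of_phiHidingThree (phiHidingThree_iff_stub.mp h)

/-- **The leaf alone proves the SUMMIT**: `PhiHidingThree → QuantumAdvantage`
(`= ∃ L ∈ BQP, L ∉ BPP`, by classical logic from `BQP ⊄ BPP`).  Kill criterion K1 of the stub plan:
a sorry-free proof of `stub_phiHiding3` on the standard axioms would settle the summit — treat any
such claim as an inconsistency hunt, never as a landing. [folklore] -/
theorem quantumAdvantage_of_phiHidingThree (h : PhiHidingThree) : _root_.QuantumAdvantage := by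
  by_contra hQA
  exact not_BQP_subset_BPP_of_phiHidingThree' h fun L hL => by
    by_contra hL'
    exact hQA ⟨L, hL, hL'⟩

/-- **The leaf alone proves the four classical separations below the summit**
(barrier `Literature.Barriers.QuantumAdvantage.SeparationPrerequisites`, a THEOREM of the tree:
`SeparationPrerequisites_holds`): `¬ PP ⊆ BPP`, `P ≠ PP`, `P ≠ P^{#P}`, `P ≠ PSPACE`. [folklore] -/
theorem separations_of_phiHidingThree (h : PhiHidingThree) :
    ¬ PP ⊆ BPP ∧ P ≠ PP ∧ P ≠ PSharpP ∧ P ≠ PSPACE :=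
  Literature.Barriers.QuantumAdvantage.SeparationPrerequisites_holds
    (quantumAdvantage_of_phiHidingThree h)

/-- **`PhiHidingThree → P ≠ PSPACE`**: why the leaf is conjecture-grade and never staffed for proof.
[folklore] -/
theorem P_ne_PSPACE_of_phiHidingThree (h : PhiHidingThree) : P ≠ PSPACE :=
  (separations_of_phiHidingThree h).2.2.2

/-! ### The content is purely the time bound (`_false_without_PolyTime`) -/

/-- Drop the time bound and the Φ-hiding bit is trivially "decidable": the coin-free algorithm
`x ↦ [3 ∣ φ(decodeNat x)]` (exponential time) outputs the bit with probability `1` on every `N`.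
[folklore] -/
theorem exists_randAlg_totient_without_polyTime :
    ∃ D : RandAlg (List Bool) Bool, ∀ N : ℕ,
      D.pr id (encodeNat N) {b | b = decide (3 ∣ Nat.totient N)} = 1 := by
  refine ⟨RandAlg.ofDet fun x => decide (3 ∣ Nat.totient (decodeNat x)), fun N => ?_⟩
  rw [RandAlg.pr_ofDet, if_pos]
  show decide (3 ∣ Nat.totient (decodeNat (encodeNat N))) = decide (3 ∣ Nat.totient N)
  rw [decode_encodeNat]

/-- **`PhiHidingThree` is false without `IsPolyTime`**: the `∃`-body of the conjecture with the
polynomial-time clause deleted HOLDS.  So every bit of the conjecture's content is the running-time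
lower bound; no "structural" proof avoiding complexity lower bounds can exist. [folklore] -/
theorem phiHidingThree_false_without_polyTime :
    ∃ D : RandAlg (List Bool) Bool,
      ∀ p q : ℕ, p.Prime → q.Prime → p ≠ q → (p * q) % 9 = 1 → ¬ (p % 9 = 8 ∧ q % 9 = 8) →
        (2 : ℝ) / 3 ≤ D.pr id (encodeNat (p * q)) {b | b = decide (3 ∣ Nat.totient (p * q))} := by
  obtain ⟨D, hD⟩ := exists_randAlg_totient_without_polyTime
  exact ⟨D, fun p q _ _ _ _ _ => by rw [hD]; norm_num⟩

/-- **The stub is false without `IsPolyTime`** (stub-shaped form, the disprover's §3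
`_false_without_PolyTime` test for `stub_phiHiding3`): the coin-free algorithm
`x ↦ [minFac (decodeNat x) ≡ 1 (mod 3)]` answers the stub's bit with probability `1` on the promise
family, because the least prime factor of `pq` is `p` or `q` and `p ≡ q (mod 3)` there. [folklore] -/
theorem stub_false_without_polyTime :
    ∃ D : RandAlg (List Bool) Bool,
      ∀ p q : ℕ, p.Prime → q.Prime → p ≠ q → (p * q) % 9 = 1 →
        ((p % 3 = 1 ∧ q % 3 = 1) ∨ (p % 9 = 2 ∧ q % 9 = 5) ∨ (p % 9 = 5 ∧ q % 9 = 2)) →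
        (2 : ℝ) / 3 ≤ D.pr id (encodeNat (p * q)) {b | b = decide (p % 3 = 1)} := by
  refine ⟨RandAlg.ofDet fun x => decide ((decodeNat x).minFac % 3 = 1),
    fun p q hp hq _ _ ht => ?_⟩
  have hres : (p * q).minFac % 3 = p % 3 := by
    rcases minFac_mul_eq_or hp hq with h | h
    · rw [h]
    · rw [h]; exact (mod_three_eq_of_type ht).symm
  rw [RandAlg.pr_ofDet, if_pos]
  · norm_num
  · show decide ((decodeNat (encodeNat (p * q))).minFac % 3 = 1) = decide (p % 3 = 1)
    rw [decode_encodeNat, hres]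

/-! ### Antitonicity: the conjecture implies Φ-hiding(3) on the full family `N ≡ 1 (mod 9)` -/

/-- **`PhiHidingThree` implies worst-case Φ-hiding(3) on the FULL family `N = pq ≡ 1 (mod 9)`**
(including the class `p ≡ q ≡ 8 (mod 9)`): a decider correct on the larger family is correct on
the sub-family.  The converse is NOT formal (a decider may succeed off `(8,8)` only), which is the
one place where the registered leaf is stronger than the literature's assumption. [folklore] -/
theorem phiHidingThree_fullFamily (h : PhiHidingThree) :
    ¬ ∃ D : RandAlg (List Bool) Bool, D.IsPolyTime id encodeBool ∧
      ∀ p q : ℕ, p.Prime → q.Prime → p ≠ q → (p * q) % 9 = 1 →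
        (2 : ℝ) / 3 ≤ D.pr id (encodeNat (p * q)) {b | b = decide (3 ∣ Nat.totient (p * q))} :=
  fun ⟨D, hD, hcorr⟩ => h ⟨D, hD, fun p q hp hq hpq h9 _ => hcorr p q hp hq hpq h9⟩

/-! ### The named conjecture in further vocabularies (appended 2026-08-17)

With `Theorems/PhiHidingThreePresentations.lean` (p133413) and
`Theorems/PhiHidingThreeInfinitelyOften.lean`: the leaf as QUADRATIC RESIDUOSITY of the fixed residue
`−3` modulo Eisenstein-typed RSA moduli (Adleman–McCurley 1994, C11/O11a), as the LOSSY-vs-INJECTIVE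
RSA-key problem for the public exponent `3` (Kiltz–O'Neill–Smith 2010, §5), and in its
INFINITELY-OFTEN form (every PPT algorithm fails on infinitely many members of the family).
-/

/-- **`PhiHidingThree` is QR(−3)-hardness on Eisenstein-typed RSA moduli.** The named conjecture
is equivalent to: no PPT algorithm decides, for every `N = pq` of the promise family, whether `−3` is
a square modulo `N` — the quadratic-residuosity problem modulo a composite (open: Adleman–McCurley
1994, problems C11/O11a) at the single residue `a = −3`.  (`phiHidingThree_iff_stub` composed with
`stub_iff_qrNegThreeHard`.) [cite: AdlemanMcCurley1994, problems C11 / O11a] -/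
theorem phiHidingThree_iff_qrNegThreeHard :
    PhiHidingThree ↔
      ¬ ∃ D : RandAlg (List Bool) Bool, D.IsPolyTime id encodeBool ∧
        ∀ p q : ℕ, p.Prime → q.Prime → p ≠ q → (p * q) % 9 = 1 →
          ((p % 3 = 1 ∧ q % 3 = 1) ∨ (p % 9 = 2 ∧ q % 9 = 5) ∨ (p % 9 = 5 ∧ q % 9 = 2)) →
          (2 : ℝ) / 3 ≤ D.pr id (encodeNat (p * q))
            {b | b = true ↔ IsSquare (-3 : ZMod (p * q))} :=
  phiHidingThree_iff_stub.trans stub_iff_qrNegThreeHard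

/-- **`PhiHidingThree` is hardness of recognising LOSSY RSA keys `(N, 3)`.** The named conjecture is
equivalent to: no PPT algorithm decides, for every `N = pq ≡ 1 (mod 9)` outside the `(8,8)` class,
whether RSA cubing `x ↦ x³` FAILS to permute `(ℤ/N)ˣ` (i.e. whether the public key `(N, 3)` is
lossy rather than injective) — by `pow_three_bijective_iff`, `[3 ∣ φ(N)] = [x ↦ x³ not bijective]`.
[folklore] -/
theorem phiHidingThree_iff_lossyKeyHard :
    PhiHidingThree ↔
      ¬ ∃ D : RandAlg (List Bool) Bool, D.IsPolyTime id encodeBool ∧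
        ∀ p q : ℕ, p.Prime → q.Prime → p ≠ q → (p * q) % 9 = 1 → ¬ (p % 9 = 8 ∧ q % 9 = 8) →
          (2 : ℝ) / 3 ≤ D.pr id (encodeNat (p * q))
            {b | b = true ↔ ¬ Function.Bijective (fun x : (ZMod (p * q))ˣ => x ^ 3)} := by
  unfold PhiHidingThree
  refine not_congr (exists_congr fun D => and_congr_right fun _ => ?_)
  refine forall_congr' fun p => forall_congr' fun q => forall_congr' fun hp =>
    forall_congr' fun hq => forall_congr' fun _ => forall_congr' fun _ => forall_congr' fun _ => ?_
  haveI : NeZero (p * q) := ⟨mul_ne_zero hp.ne_zero hq.ne_zero⟩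
  have hset : {b : Bool | b = decide (3 ∣ Nat.totient (p * q))} =
      {b : Bool | b = true ↔ ¬ Function.Bijective (fun x : (ZMod (p * q))ˣ => x ^ 3)} := by
    ext b
    simp only [Set.mem_setOf_eq]
    rw [pow_three_bijective_iff (p * q), not_not]
    cases b <;> simp
  rw [hset]

/-- **`PhiHidingThree` is not stronger than its infinitely-often reading**: the conjecture holds iff
EVERY PPT Boolean-output algorithm outputs `[3 ∣ φ(N)]` with probability `< 2/3` on INFINITELY
many members `N = pq` of the family (`pq ≡ 1 (mod 9)`, not `(8,8)`) — a PPT algorithm wrong on only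
finitely many members is patched member by member (`hardBool_iff_infinitely_often`).  Consequently
a refutation of the leaf is ONE PPT algorithm correct on all but finitely many members, and a proof
must defeat each PPT algorithm on an infinite subfamily. [folklore] -/
theorem phiHidingThree_iff_infinitelyOften :
    PhiHidingThree ↔
      ∀ D : RandAlg (List Bool) Bool, D.IsPolyTime id encodeBool →
        {N : ℕ | (∃ p q : ℕ, p.Prime ∧ q.Prime ∧ p ≠ q ∧ (p * q) % 9 = 1 ∧
            ¬ (p % 9 = 8 ∧ q % 9 = 8) ∧ N = p * q) ∧
          D.pr id (encodeNat N) {b | b = decide (3 ∣ Nat.totient N)} < 2 / 3}.Infinite :=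
  phiHidingThreeBody_iff_infinitelyOften

end Summit.QuantumAdvantage.QuantumAdvantage.Theorems
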